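import Literature.NumberTheory.Transcendental.RoySmallValueBasic
import Literature.NumberTheory.Transcendental.IntegerTaylor
import Mathlib.Analysis.Complex.TaylorSeries
import Mathlib.Analysis.SpecialFunctions.Exponential
import Mathlib.Analysis.SpecialFunctions.ExpDeriv
import HarnessLib

/-!
# Roy's small value estimate for `𝔾ₐ × 𝔾ₘ` — the entire function `f(z) = P(1, ξ + z, η e^z)` (§4)

Topic `Literature/NumberTheory/Transcendental`. Part of the formalisation of the proof of Roy 2013,
Theorem 1.1 (named fact `roy2013_thm_1_1`, `RoySmallValueEstimates.lean`). Source: D. Roy,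
*A small value estimate for `𝔾ₐ × 𝔾ₘ`*, Mathematika 59 (2013) 333–363 = arXiv:1301.0663, §4,
proof of Proposition 4.2 (p. 11 of the arXiv text): "consider the entire function
`f : ℂ → ℂ` given by `f(z) = P(1, ξ + z, η e^z)` … since `f^{(i)}(0) = 𝒟ⁱP(1, ξ, η)` for each
`i ∈ ℕ` …".

Contents (all proved):

* `expEvalH P ξ η z = P(1, ξ + z, η e^z)`; `hasDerivAt_expEvalH` (`f' = f_{𝒟P}`, the chain rule
  against `𝒟 = X₀∂/∂X₁ + X₂∂/∂X₂`), `iteratedDeriv_expEvalH` (`f^{(i)} = f_{𝒟ⁱP}`, so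
  `f^{(i)}(0) = 𝒟ⁱP(1, ξ, η)`, `iteratedDeriv_expEvalH_zero`);
* `norm_le_of_iteratedDeriv_bounds` — the Taylor-series estimate behind Proposition 4.2: for an
  entire `g` with `|g^{(n)}(0)| ≤ B` (`n < T`) and `|g^{(n)}(0)| ≤ C Kⁿ` (all `n`), and
  `|w| ≤ λ ε` with `0 ≤ ε ≤ 1`: `|g(w)| ≤ B e^λ + C e^{Kλ} ε^T`;
* `aeval_smul_of_isHomogeneous` — `P(c x) = c^D P(x)` for `P ∈ ℂ[X]_D`;
* `norm_aeval_sub_aeval_le_l1Norm` — `|P(x) - P(y)| ≤ 𝓛(P) D A^D ε` (Lipschitz bound, from the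
  tree's `norm_monomial_sub_le`).

One definition (`expEvalH`), no new named facts.

## References

* [Roy2013] D. Roy, *A small value estimate for 𝔾ₐ × 𝔾ₘ*, Mathematika 59 (2013), 333–363
  (arXiv:1301.0663), §4, proof of Proposition 4.2.
-/

noncomputable section

open MvPolynomial Finset Complex

namespace Literature.NumberTheory.Transcendental

namespace Roy2013

open Nesterenko

/-! ### The function `f(z) = P(1, ξ + z, η e^z)` -/

/-- `f_P(z) = P(1, ξ + z, η e^z)`, the restriction of `P ∈ ℂ[X₀, X₁, X₂]` to the translate by
`γ = (ξ, η)` of the one-parameter subgroup `z ↦ (1, z, e^z)` of `𝒢`.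
[cite: Roy2013, §4, proof of Proposition 4.2] -/
def expEvalH (P : CX) (ξ η z : ℂ) : ℂ := aeval ![1, ξ + z, η * cexp z] P

/-- `f_P(0) = P(1, ξ, η)`. [cite: Roy2013, §4, proof of Proposition 4.2] -/
theorem expEvalH_zero (P : CX) (ξ η : ℂ) : expEvalH P ξ η 0 = aeval ![1, ξ, η] P := by
  simp [expEvalH]

/-- `f_{PQ} = f_P f_Q`, `f_{P+Q} = f_P + f_Q`, `f_{C a} = a`, and the three variables.
[folklore] -/
theorem expEvalH_mul_X (P : CX) (ξ η : ℂ) (i : Fin 3) (w : ℂ) :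
    expEvalH (P * X i) ξ η w = expEvalH P ξ η w * (![1, ξ + w, η * cexp w] : Fin 3 → ℂ) i := by
  simp only [expEvalH, map_mul, aeval_X]

/-- **`f_P' = f_{𝒟P}`** (chain rule). [cite: Roy2013, §4, proof of Proposition 4.2] -/
theorem hasDerivAt_expEvalH (P : CX) (ξ η z : ℂ) :
    HasDerivAt (expEvalH P ξ η) (expEvalH (homD P) ξ η z) z := by
  induction P using MvPolynomial.induction_on with
  | C a =>
    have h1 : expEvalH (C a) ξ η = fun _ => a := by ext w; simp [expEvalH]
    rw [h1, homD_C, expEvalH, map_zero]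
    exact hasDerivAt_const _ _
  | add p q hp hq =>
    have h1 : expEvalH (p + q) ξ η = fun w => expEvalH p ξ η w + expEvalH q ξ η w := by
      ext w; simp [expEvalH]
    rw [h1, map_add, expEvalH, map_add]
    exact hp.add hq
  | mul_X p i hp =>
    have h1 : expEvalH (p * X i) ξ η =
        fun w => expEvalH p ξ η w * (![1, ξ + w, η * cexp w] : Fin 3 → ℂ) i := by
      ext w; exact expEvalH_mul_X p ξ η i w
    have h2 : expEvalH (homD (p * X i)) ξ η z =
        expEvalH p ξ η z * expEvalH (homD (X i)) ξ η z +
          (![1, ξ + z, η * cexp z] : Fin 3 → ℂ) i * expEvalH (homD p) ξ η z := by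
      unfold expEvalH
      rw [Derivation.leibniz, smul_eq_mul, smul_eq_mul, map_add, map_mul, map_mul, aeval_X]
    rw [h1, h2]
    fin_cases i
    · change HasDerivAt (fun w => expEvalH p ξ η w * 1)
        (expEvalH p ξ η z * expEvalH (homD (X 0)) ξ η z + 1 * expEvalH (homD p) ξ η z) z
      have e : expEvalH p ξ η z * expEvalH (homD (X 0)) ξ η z + 1 * expEvalH (homD p) ξ η z =
          expEvalH (homD p) ξ η z * 1 + expEvalH p ξ η z * 0 := by
        rw [homD_X_zero]; unfold expEvalH; rw [map_zero]; ring
      rw [e]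
      exact hp.mul (hasDerivAt_const z (1 : ℂ))
    · change HasDerivAt (fun w => expEvalH p ξ η w * (ξ + w))
        (expEvalH p ξ η z * expEvalH (homD (X 1)) ξ η z + (ξ + z) * expEvalH (homD p) ξ η z) z
      have e : expEvalH p ξ η z * expEvalH (homD (X 1)) ξ η z + (ξ + z) * expEvalH (homD p) ξ η z =
          expEvalH (homD p) ξ η z * (ξ + z) + expEvalH p ξ η z * 1 := by
        rw [homD_X_one]; unfold expEvalH; rw [aeval_X]
        change _ * (1 : ℂ) + _ = _
        ring
      rw [e]
      exact hp.mul ((hasDerivAt_id z).const_add ξ)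
    · change HasDerivAt (fun w => expEvalH p ξ η w * (η * cexp w))
        (expEvalH p ξ η z * expEvalH (homD (X 2)) ξ η z + η * cexp z * expEvalH (homD p) ξ η z) z
      have e : expEvalH p ξ η z * expEvalH (homD (X 2)) ξ η z + η * cexp z * expEvalH (homD p) ξ η z =
          expEvalH (homD p) ξ η z * (η * cexp z) + expEvalH p ξ η z * (η * cexp z) := by
        rw [homD_X_two]; unfold expEvalH; rw [aeval_X]
        change _ * (η * cexp z) + _ = _
        ring
      rw [e]
      exact hp.mul ((Complex.hasDerivAt_exp z).const_mul η)

/-- `(f_P)' = f_{𝒟P}`. [cite: Roy2013, §4, proof of Proposition 4.2] -/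
theorem deriv_expEvalH (P : CX) (ξ η : ℂ) : deriv (expEvalH P ξ η) = expEvalH (homD P) ξ η := by
  ext z; exact (hasDerivAt_expEvalH P ξ η z).deriv

/-- `f_P` is entire. [cite: Roy2013, §4, proof of Proposition 4.2] -/
theorem differentiable_expEvalH (P : CX) (ξ η : ℂ) : Differentiable ℂ (expEvalH P ξ η) :=
  fun z => (hasDerivAt_expEvalH P ξ η z).differentiableAt

/-- **`f_P^{(i)} = f_{𝒟ⁱP}`**. [cite: Roy2013, §4, proof of Proposition 4.2] -/
theorem iteratedDeriv_expEvalH (k : ℕ) (P : CX) (ξ η : ℂ) :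
    iteratedDeriv k (expEvalH P ξ η) = expEvalH (homD^[k] P) ξ η := by
  induction k generalizing P with
  | zero => simp
  | succ k ih => rw [iteratedDeriv_succ', deriv_expEvalH, ih, Function.iterate_succ_apply]

/-- **`f_P^{(i)}(0) = 𝒟ⁱP(1, ξ, η)`**. [cite: Roy2013, §4, proof of Proposition 4.2] -/
theorem iteratedDeriv_expEvalH_zero (k : ℕ) (P : CX) (ξ η : ℂ) :
    iteratedDeriv k (expEvalH P ξ η) 0 = aeval ![1, ξ, η] (homD^[k] P) := by
  rw [iteratedDeriv_expEvalH, expEvalH_zero]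

/-! ### A Taylor-series estimate for entire functions -/

/-- **Taylor-series estimate** (the analytic heart of Proposition 4.2): let `g` be entire with
`|g^{(n)}(0)| ≤ B` for `n < T` and `|g^{(n)}(0)| ≤ C Kⁿ` for all `n`; if `|w| ≤ λ ε` with
`0 ≤ ε ≤ 1`, then `|g(w)| ≤ B e^λ + C e^{Kλ} ε^T`. (Roy: split `f(δ₁) = ∑ f^{(i)}(0) δ₁ⁱ/i!` at
`i = T` and use `|δ₁|ⁱ ≤ (2c₂²)ⁱ dist^T` for `i ≥ T`.) [cite: Roy2013, §4, proof of Proposition 4.2] -/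
theorem norm_le_of_iteratedDeriv_bounds {g : ℂ → ℂ} (hg : Differentiable ℂ g) {T : ℕ}
    {B C K lam ε : ℝ} (hB0 : 0 ≤ B) (hC0 : 0 ≤ C) (hK0 : 0 ≤ K) (hlam : 0 ≤ lam) (hε0 : 0 ≤ ε)
    (hε1 : ε ≤ 1) (hB : ∀ n < T, ‖iteratedDeriv n g 0‖ ≤ B)
    (hC : ∀ n, ‖iteratedDeriv n g 0‖ ≤ C * K ^ n) {w : ℂ} (hw : ‖w‖ ≤ lam * ε) :
    ‖g w‖ ≤ B * Real.exp lam + C * Real.exp (K * lam) * ε ^ T := by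
  have hsum := Complex.hasSum_taylorSeries_of_entire hg 0 w
  have hwlam : ‖w‖ ≤ lam := hw.trans (mul_le_of_le_one_right hlam hε1)
  -- the two majorants
  set u : ℕ → ℝ := fun n => if n < T then B * (lam ^ n / n.factorial) else 0 with hu_def
  set v : ℕ → ℝ := fun n => C * ε ^ T * ((K * lam) ^ n / n.factorial) with hv_def
  have hu : HasSum u (∑ n ∈ range T, B * (lam ^ n / n.factorial)) := by
    have : ∑ n ∈ range T, B * (lam ^ n / n.factorial) = ∑ n ∈ range T, u n :=
      Finset.sum_congr rfl fun n hn => by rw [hu_def]; dsimp only; rw [if_pos (mem_range.mp hn)]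
    rw [this]
    refine hasSum_sum_of_ne_finset_zero fun n hn => ?_
    rw [hu_def]; dsimp only; rw [if_neg (fun h => hn (mem_range.mpr h))]
  have hv : HasSum v (C * ε ^ T * Real.exp (K * lam)) := by
    have h := NormedSpace.expSeries_div_hasSum_exp (K * lam)
    rw [← congr_fun Real.exp_eq_exp_ℝ (K * lam)] at h
    exact h.mul_left (C * ε ^ T)
  -- termwise comparison
  have hbound : ∀ n, ‖(n.factorial : ℂ)⁻¹ • (w - 0) ^ n • iteratedDeriv n g 0‖ ≤ u n + v n := by
    intro n
    rw [sub_zero, norm_smul, norm_smul, norm_inv, Complex.norm_natCast, norm_pow]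
    have hv0 : 0 ≤ v n := by rw [hv_def]; positivity
    have hu0 : 0 ≤ u n := by rw [hu_def]; dsimp only; split_ifs <;> positivity
    have hfac : (0 : ℝ) < n.factorial := by exact_mod_cast n.factorial_pos
    by_cases hn : n < T
    · -- `n < T`: use `B`
      calc (n.factorial : ℝ)⁻¹ * (‖w‖ ^ n * ‖iteratedDeriv n g 0‖)
          ≤ (n.factorial : ℝ)⁻¹ * (lam ^ n * B) := by
            refine mul_le_mul_of_nonneg_left (mul_le_mul (pow_le_pow_left₀ (norm_nonneg _)
              hwlam n) (hB n hn) (norm_nonneg _) (by positivity)) (by positivity)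
        _ = u n := by rw [hu_def]; dsimp only; rw [if_pos hn]; field_simp
        _ ≤ u n + v n := le_add_of_nonneg_right hv0
    · -- `n ≥ T`: use `C Kⁿ` and `|w|ⁿ ≤ λⁿ εⁿ ≤ λⁿ ε^T`
      push Not at hn
      have hεn : ε ^ n ≤ ε ^ T := pow_le_pow_of_le_one hε0 hε1 hn
      calc (n.factorial : ℝ)⁻¹ * (‖w‖ ^ n * ‖iteratedDeriv n g 0‖)
          ≤ (n.factorial : ℝ)⁻¹ * ((lam * ε) ^ n * (C * K ^ n)) := by
            refine mul_le_mul_of_nonneg_left (mul_le_mul (pow_le_pow_left₀ (norm_nonneg _)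
              hw n) (hC n) (norm_nonneg _) (by positivity)) (by positivity)
        _ = C * ε ^ n * ((K * lam) ^ n / n.factorial) := by
            rw [mul_pow, mul_pow]; field_simp
        _ ≤ v n := by
            rw [hv_def]
            exact mul_le_mul_of_nonneg_right (mul_le_mul_of_nonneg_left hεn hC0) (by positivity)
        _ ≤ u n + v n := le_add_of_nonneg_left hu0
  refine (hsum.norm_le_of_bounded (hu.add hv) hbound).trans ?_
  have hexp : ∑ n ∈ range T, B * (lam ^ n / n.factorial) ≤ B * Real.exp lam := by
    rw [← Finset.mul_sum]
    exact mul_le_mul_of_nonneg_left (Real.sum_le_exp_of_nonneg hlam T) hB0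
  nlinarith [Real.exp_pos (K * lam), pow_nonneg hε0 T]

/-! ### Homogeneity and a Lipschitz bound -/

/-- `P(c x) = c^D P(x)` for `P ∈ ℂ[X]_D`. [folklore] -/
theorem aeval_smul_of_isHomogeneous {P : CX} {D : ℕ} (hP : P.IsHomogeneous D) (c : ℂ)
    (x : Fin 3 → ℂ) : aeval (c • x) P = c ^ D * aeval x P := by
  change eval (c • x) P = c ^ D * eval x P
  rw [eval_eq', eval_eq', Finset.mul_sum]
  refine Finset.sum_congr rfl fun ν hν => ?_
  have hdeg : ∑ i, ν i = D := by
    have h : ν.degree = D := by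
      rw [Finsupp.degree_eq_weight_one]; exact hP (mem_support_iff.mp hν)
    rwa [Finsupp.degree_eq_sum] at h
  simp only [Pi.smul_apply, smul_eq_mul, mul_pow, Finset.prod_mul_distrib,
    Finset.prod_pow_eq_pow_sum, hdeg]
  ring

/-- **Lipschitz bound**: if `|xᵢ|, |yᵢ| ≤ A` (`A ≥ 1`), `|xᵢ - yᵢ| ≤ ε` and `P` has total
degree `≤ D`, then `|P(x) - P(y)| ≤ 𝓛(P) D A^D ε`. [folklore] -/
theorem norm_aeval_sub_aeval_le_l1Norm (P : CX) {D : ℕ} (hP : P.totalDegree ≤ D)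
    (x y : Fin 3 → ℂ) {A ε : ℝ} (hA : 1 ≤ A) (hε0 : 0 ≤ ε) (hx : ∀ i, ‖x i‖ ≤ A)
    (hy : ∀ i, ‖y i‖ ≤ A) (hε : ∀ i, ‖x i - y i‖ ≤ ε) :
    ‖aeval x P - aeval y P‖ ≤ l1Norm P * (D * A ^ D * ε) := by
  classical
  have hA0 : 0 ≤ A := zero_le_one.trans hA
  rw [aeval_def, aeval_def, eval₂_eq, eval₂_eq, ← Finset.sum_sub_distrib, l1Norm, Finset.sum_mul]
  refine (norm_sum_le _ _).trans (Finset.sum_le_sum fun d hd => ?_)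
  rw [← mul_sub, norm_mul]
  refine mul_le_mul_of_nonneg_left ?_ (norm_nonneg _)
  refine (norm_monomial_sub_le d x y hA hε0 hx hy hε).trans ?_
  have hdeg : d.degree ≤ D := (le_totalDegree hd).trans hP
  have h1 : ((d.degree : ℕ) : ℝ) ≤ D := by exact_mod_cast hdeg
  have h2 : A ^ d.degree ≤ A ^ D := pow_le_pow_right₀ hA hdeg
  exact mul_le_mul (mul_le_mul h1 h2 (by positivity) (by positivity)) le_rfl hε0 (by positivity)

end Roy2013

end Literature.NumberTheory.Transcendental
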